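import Summits.CriticalPhenomena.PercolationContinuityZ3.Theorems.PercNearOneGluingNoHeavyLowerTailKnQuestion8CoefficientwiseCoreClassKernelMixBundleCanonicalSlab
import HarnessLib

/-!
# Boundary inequality on bundles, XII: THEOREM RS (the canonical three-slab certificate for red-starting sources)

Support file (`--supports stmt-CriticalPhenomena-4575`, closed), prover `prim-cplus-coupling` (gen 57).  No definitions, no notations, no named facts,
no sorries; standard axioms.  Memo `prim-cplus-coupling/A5-COUPLING-gen56.md` §3.8 (STRUCTURE THEOREM, THEOREM RS, pencil) and `A5-COUPLING-gen57.md` §3.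

SETTING as in `…KernelMixBundleTwoCorner`: an explicit bundle whose threads are exactly `s₀, s₁, s₂`, an up-closed event `𝒱`, monotone `{0,1}` levels.
THE CANONICAL CERTIFICATE (memo gen 56 §2): each type runs THREE slab schemes — slab `s₀` (sources with `s₀` blue), slab `s₁` (sources with `s₁` blue and
`s₀` not blue), slab `s₂` (sources with `s₂` blue, `s₀, s₁` not blue) — each freezing every other thread on which all of its sources start red.
* `Coefficientwise.bundle_rs_count` (THEOREM RS): if every source of `𝒱` (of either type) starts red on each of its non-blue threads, then
  `#bad₁(𝒱) + #bad₂(𝒱) ≤ #(L₁ ∪ L₂)(𝒱) + #P₁(𝒱)`.  Proof: by `bundle_slab_scheme_count` (with the slab restrictions folded into the event) each type's three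
  landing sets are pairwise disjoint (a later slab freezes the earlier slab threads); landings of different types in different slabs are disjoint for the
  same reason; a common landing of the two types in one slab has a common pre-lift which is a JOIN of `𝒱` (an unfrozen full thread would give doubly-blue
  sources of both types with comparable red clusters — `bundle_boundary_chain`), and pre-lifts determine their slab.  With the layer cake: `IET(𝒱) ≥ 0` for all
  monotone levels; exact SAT cross-check BCLFRS (memo gen 56 §3.8, kit j223092).
[cite: KozmaNitzan2024, Questions 8–9 (§5.5 p. 36) (context); Harris 1960]
-/

namespace Summit.CriticalPhenomena.PercolationContinuityZ3.Theorems

open Finset Literature.Probability.Percolation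

namespace Coefficientwise

variable {ι V : Type*}

open Classical in
/-- **THEOREM RS (all 0/1 levels, three threads).**  On an explicit bundle with threads exactly `s₀, s₁, s₂`, if every source of the up-closed event `𝒱` starts
red on each of its threads that is not fully blue (`hRS₁`, `hRS₂`), then
`#bad₁(𝒱) + #bad₂(𝒱) ≤ #(L₁ ∪ L₂)(𝒱) + #P₁(𝒱)` (whole cube; demand sources, supply targets, joins).  Memo gen 56 §3.8, gen 57 §3.
[cite: KozmaNitzan2024, Questions 8–9 (§5.5 p. 36) (context); Harris 1960] -/
theorem bundle_rs_count (ends : ι → Sym2 V) (r : ℕ) (L : ℕ → ℕ) (hL : ∀ t, t < r → 1 ≤ L t)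
    (w : ℕ → ℕ → V) (e : ℕ → ℕ → ι) (u b : V)
    (hw0 : ∀ t, t < r → w t 0 = u) (hwL : ∀ t, t < r → w t (L t) = b)
    (harc : ∀ t, t < r → ∀ j, 1 ≤ j → j ≤ L t → ends (e t j) = s(w t (j - 1), w t j))
    (hwinj : ∀ t, t < r → ∀ i j, i ≤ L t → j ≤ L t → w t i = w t j → i = j)
    (hcross : ∀ t t', t < r → t' < r → t ≠ t' → ∀ i j, i ≤ L t → j ≤ L t' → w t i = w t' j → (i = 0 ∧ j = 0) ∨ (i = L t ∧ j = L t'))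
    (A : ℕ → Finset ι) (hA : ∀ t, t < r → ∀ i, i ∈ A t ↔ ∃ j, 1 ≤ j ∧ j ≤ L t ∧ e t j = i)
    (hAdisj : ∀ t t', t < r → t' < r → t ≠ t' → Disjoint (A t) (A t'))
    (E : Finset ι) (hEA : ∀ i, i ∈ E ↔ ∃ t, t < r ∧ i ∈ A t)
    (s₀ s₁ s₂ : ℕ) (hs₀ : s₀ < r) (hs₁ : s₁ < r) (hs₂ : s₂ < r) (h01 : s₀ ≠ s₁) (h02 : s₀ ≠ s₂) (h12 : s₁ ≠ s₂)
    (hr3 : ∀ t, t < r → t = s₀ ∨ t = s₁ ∨ t = s₂)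
    (𝒱 : Finset ι → Prop) (hV : ∀ ⦃s t : Finset ι⦄, s ⊆ t → 𝒱 s → 𝒱 t)
    (ha hb ka kb : Set V → ℝ) (mha : Monotone ha) (mhb : Monotone hb) (mka : Monotone ka) (mkb : Monotone kb)
    (ha01 : ∀ S, ha S = 0 ∨ ha S = 1) (hb01 : ∀ S, hb S = 0 ∨ hb S = 1) (ka01 : ∀ S, ka S = 0 ∨ ka S = 1) (kb01 : ∀ S, kb S = 0 ∨ kb S = 1)
    (hRS₁ : ∀ σ, σ ⊆ E → (𝒱 σ ∧ (b ∈ openCluster (ends '' (↑(E \ σ) : Set ι)) u ∧ b ∉ openCluster (ends '' (↑σ : Set ι)) u) ∧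
        (ha (openCluster (ends '' (↑σ : Set ι)) u) = 1 ∧ hb (openCluster (ends '' (↑(E \ σ) : Set ι)) u) = 0) ∧
        (kb (openCluster (ends '' (↑(E \ σ) : Set ι)) u) = 1 ∧ ka (openCluster (ends '' (↑σ : Set ι)) u) = 0)) →
        ∀ t, t < r → ¬ Disjoint (A t) σ → e t 1 ∈ σ)
    (hRS₂ : ∀ σ, σ ⊆ E → (𝒱 σ ∧ (b ∈ openCluster (ends '' (↑(E \ σ) : Set ι)) u ∧ b ∉ openCluster (ends '' (↑σ : Set ι)) u) ∧
        (ka (openCluster (ends '' (↑σ : Set ι)) u) = 1 ∧ kb (openCluster (ends '' (↑(E \ σ) : Set ι)) u) = 0) ∧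
        (hb (openCluster (ends '' (↑(E \ σ) : Set ι)) u) = 1 ∧ ha (openCluster (ends '' (↑σ : Set ι)) u) = 0)) →
        ∀ t, t < r → ¬ Disjoint (A t) σ → e t 1 ∈ σ) :
    ((E.powerset).filter (fun σ => 𝒱 σ ∧
        (b ∈ openCluster (ends '' (↑(E \ σ) : Set ι)) u ∧ b ∉ openCluster (ends '' (↑σ : Set ι)) u) ∧
        (ha (openCluster (ends '' (↑σ : Set ι)) u) = 1 ∧ hb (openCluster (ends '' (↑(E \ σ) : Set ι)) u) = 0) ∧
        (kb (openCluster (ends '' (↑(E \ σ) : Set ι)) u) = 1 ∧ ka (openCluster (ends '' (↑σ : Set ι)) u) = 0))).card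
    + ((E.powerset).filter (fun σ => 𝒱 σ ∧
        (b ∈ openCluster (ends '' (↑(E \ σ) : Set ι)) u ∧ b ∉ openCluster (ends '' (↑σ : Set ι)) u) ∧
        (ka (openCluster (ends '' (↑σ : Set ι)) u) = 1 ∧ kb (openCluster (ends '' (↑(E \ σ) : Set ι)) u) = 0) ∧
        (hb (openCluster (ends '' (↑(E \ σ) : Set ι)) u) = 1 ∧ ha (openCluster (ends '' (↑σ : Set ι)) u) = 0))).card
    ≤ ((E.powerset).filter (fun lam => 𝒱 lam ∧
        (b ∈ openCluster (ends '' (↑lam : Set ι)) u ∧ b ∉ openCluster (ends '' (↑(E \ lam) : Set ι)) u) ∧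
        ((ha (openCluster (ends '' (↑lam : Set ι)) u) = 1 ∧ kb (openCluster (ends '' (↑lam : Set ι)) u) = 1 ∧
            hb (openCluster (ends '' (↑(E \ lam) : Set ι)) u) = 0 ∧ ka (openCluster (ends '' (↑(E \ lam) : Set ι)) u) = 0) ∨
          (ka (openCluster (ends '' (↑lam : Set ι)) u) = 1 ∧ hb (openCluster (ends '' (↑lam : Set ι)) u) = 1 ∧
            kb (openCluster (ends '' (↑(E \ lam) : Set ι)) u) = 0 ∧ ha (openCluster (ends '' (↑(E \ lam) : Set ι)) u) = 0)))).card
      + ((E.powerset).filter (fun π => 𝒱 π ∧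
        (b ∈ openCluster (ends '' (↑(E \ π) : Set ι)) u ∧ b ∉ openCluster (ends '' (↑π : Set ι)) u) ∧
        (ha (openCluster (ends '' (↑π : Set ι)) u) = 1 ∧ ka (openCluster (ends '' (↑π : Set ι)) u) = 1 ∧
          hb (openCluster (ends '' (↑(E \ π) : Set ι)) u) = 0 ∧ kb (openCluster (ends '' (↑(E \ π) : Set ι)) u) = 0))).card := by
  set C : Finset ι → Set V := fun ω => openCluster (ends '' (↑ω : Set ι)) u with hC
  -- ## bookkeeping
  have hr : 0 < r := lt_of_le_of_lt (Nat.zero_le s₀) hs₀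
  have hAE : ∀ t, t < r → A t ⊆ E := fun t ht i hi => (hEA i).mpr ⟨t, ht, hi⟩
  have heA : ∀ t, t < r → ∀ j, 1 ≤ j → j ≤ L t → e t j ∈ A t := fun t ht j hj1 hjL => (hA t ht _).mpr ⟨j, hj1, hjL, rfl⟩
  have hE : ∀ i, i ∈ E → ∃ t, t < r ∧ ∃ j, 1 ≤ j ∧ j ≤ L t ∧ e t j = i := fun i hi => by
    obtain ⟨t, ht, hit⟩ := (hEA i).mp hi; exact ⟨t, ht, (hA t ht i).mp hit⟩
  have full_iff : ∀ ω : Finset ι, ω ⊆ E → (b ∈ C ω ↔ ∃ t, t < r ∧ A t ⊆ ω) := fun ω hω =>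
    bundle_b_mem_cluster_iff_threads ends r L hL w e u b hr hw0 hwL harc hwinj hcross A hA E hEA ω hω
  have one_of_ge : ∀ (f : Set V → ℝ), (∀ S, f S = 0 ∨ f S = 1) → ∀ S S' : Set V, S ⊆ S' → Monotone f → f S = 1 → f S' = 1 :=
    fun f f01 S S' hSS' mf h1 => (f01 S').elim (fun h0 => by have := mf hSS'; rw [h1, h0] at this; linarith) id
  have nofull : ∀ σ : Finset ι, σ ⊆ E → b ∉ C σ → ∀ t, t < r → ∃ j, 1 ≤ j ∧ j ≤ L t ∧ e t j ∉ σ := by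
    intro σ hσ hb' t ht
    by_contra hno
    push Not at hno
    exact hb' ((full_iff σ hσ).mpr ⟨t, ht, fun x hx => by
      obtain ⟨j, hj1, hjL, rfl⟩ := (hA t ht x).mp hx
      exact hno j hj1 hjL⟩)
  have A_ne : ∀ t, t < r → (A t).Nonempty := fun t ht => ⟨e t 1, heA t ht 1 (le_refl 1) (hL t ht)⟩
  have third : ∀ t t', t < r → t' < r → t ≠ t' → ∃ o, o < r ∧ o ≠ t ∧ o ≠ t' ∧ ∀ t'', t'' < r → t'' ≠ o → (t'' = t ∨ t'' = t') := by
    intro t t' ht ht' htt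
    rcases hr3 t ht with h | h | h <;> rcases hr3 t' ht' with h' | h' | h' <;>
      first | exact ⟨s₂, hs₂, by omega, by omega, fun t'' ht'' hto => by have := hr3 t'' ht''; omega⟩ |
        exact ⟨s₁, hs₁, by omega, by omega, fun t'' ht'' hto => by have := hr3 t'' ht''; omega⟩ |
        exact ⟨s₀, hs₀, by omega, by omega, fun t'' ht'' hto => by have := hr3 t'' ht''; omega⟩
  -- the three restricted events (slab k keeps the earlier slab threads non-blue)
  obtain ⟨V1, hV1⟩ : ∃ f : Finset ι → Prop, f = fun σ => 𝒱 σ ∧ ¬ Disjoint (A s₀) σ := ⟨_, rfl⟩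
  obtain ⟨V2, hV2⟩ : ∃ f : Finset ι → Prop, f = fun σ => 𝒱 σ ∧ ¬ Disjoint (A s₀) σ ∧ ¬ Disjoint (A s₁) σ := ⟨_, rfl⟩
  have V1_mono : ∀ ⦃s t : Finset ι⦄, s ⊆ t → V1 s → V1 t := by
    intro s t hst hs; rw [hV1] at hs ⊢; exact ⟨hV hst hs.1, fun hd => hs.2 (Finset.disjoint_of_subset_right hst hd)⟩
  have V2_mono : ∀ ⦃s t : Finset ι⦄, s ⊆ t → V2 s → V2 t := by
    intro s t hst hs; rw [hV2] at hs ⊢; exact ⟨hV hst hs.1, fun hd => hs.2.1 (Finset.disjoint_of_subset_right hst hd), fun hd => hs.2.2 (Finset.disjoint_of_subset_right hst hd)⟩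
  have hV1w : ∀ σ, V1 σ → 𝒱 σ := fun σ h => by rw [hV1] at h; exact h.1
  have hV2w : ∀ σ, V2 σ → 𝒱 σ := fun σ h => by rw [hV2] at h; exact h.1
  have hr3' : ∀ t', t' < r → t' = s₁ ∨ t' = s₀ ∨ t' = s₂ := fun t' ht' => by rcases hr3 t' ht' with h | h | h <;> simp [h]
  have hr3'' : ∀ t', t' < r → t' = s₂ ∨ t' = s₀ ∨ t' = s₁ := fun t' ht' => by rcases hr3 t' ht' with h | h | h <;> simp [h]
  -- ## the six canonical slab schemes (type 1 with levels (ha,hb,ka,kb), type 2 with (ka,kb,ha,hb))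
  have slab := fun (f₁ f₂ g₁ g₂ : Set V → ℝ) (m₁ : Monotone f₁) (m₂ : Monotone f₂) (n₁ : Monotone g₁) (n₂ : Monotone g₂)
      (f₁01 : ∀ S, f₁ S = 0 ∨ f₁ S = 1) (f₂01 : ∀ S, f₂ S = 0 ∨ f₂ S = 1) (g₁01 : ∀ S, g₁ S = 0 ∨ g₁ S = 1) (g₂01 : ∀ S, g₂ S = 0 ∨ g₂ S = 1)
      (t p q : ℕ) (ht : t < r) (hp : p < r) (hq : q < r) (htp : t ≠ p) (htq : t ≠ q) (hpq : p ≠ q) (h3 : ∀ t', t' < r → t' = t ∨ t' = p ∨ t' = q)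
      (W : Finset ι → Prop) (hW : ∀ ⦃s t : Finset ι⦄, s ⊆ t → W s → W t) =>
    bundle_canonical_slab ends r L hL w e u b hw0 hwL harc hwinj hcross A hA hAdisj E hEA t p q ht hp hq htp htq hpq h3 W hW
      f₁ f₂ g₁ g₂ m₁ m₂ n₁ n₂ f₁01 f₂01 g₁01 g₂01
  obtain ⟨M10, le10, mem10, wit10⟩ := slab ha hb ka kb mha mhb mka mkb ha01 hb01 ka01 kb01 s₀ s₁ s₂ hs₀ hs₁ hs₂ h01 h02 h12 hr3 𝒱 hV
  obtain ⟨M11, le11, mem11, wit11⟩ := slab ha hb ka kb mha mhb mka mkb ha01 hb01 ka01 kb01 s₁ s₀ s₂ hs₁ hs₀ hs₂ h01.symm h12 h02 hr3' V1 V1_mono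
  obtain ⟨M12, le12, mem12, wit12⟩ := slab ha hb ka kb mha mhb mka mkb ha01 hb01 ka01 kb01 s₂ s₀ s₁ hs₂ hs₀ hs₁ h02.symm h12.symm h01 hr3'' V2 V2_mono
  obtain ⟨M20, le20, mem20, wit20⟩ := slab ka kb ha hb mka mkb mha mhb ka01 kb01 ha01 hb01 s₀ s₁ s₂ hs₀ hs₁ hs₂ h01 h02 h12 hr3 𝒱 hV
  obtain ⟨M21, le21, mem21, wit21⟩ := slab ka kb ha hb mka mkb mha mhb ka01 kb01 ha01 hb01 s₁ s₀ s₂ hs₁ hs₀ hs₂ h01.symm h12 h02 hr3' V1 V1_mono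
  obtain ⟨M22, le22, mem22, wit22⟩ := slab ka kb ha hb mka mkb mha mhb ka01 kb01 ha01 hb01 s₂ s₀ s₁ hs₂ hs₀ hs₁ h02.symm h12.symm h01 hr3'' V2 V2_mono
  -- ## full threads of the landings: the slab thread is full, the earlier slab threads are not
  have nf1 : ∀ (M : Finset (Finset ι)) (st : Finset ι → Prop), (∀ σ, σ ⊆ E → (𝒱 σ ∧ (b ∈ C (E \ σ) ∧ b ∉ C σ) ∧ st σ) →
      ∀ t', t' < r → ¬ Disjoint (A t') σ → e t' 1 ∈ σ) → (∀ lam ∈ M, ∀ t', t' < r → t' ≠ s₁ → A t' ⊆ lam → ∃ σ, σ ⊆ E ∧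
      Disjoint (A s₁) σ ∧ e t' 1 ∉ σ ∧ (V1 σ ∧ (b ∈ C (E \ σ) ∧ b ∉ C σ) ∧ st σ)) → ∀ lam ∈ M, ¬ A s₀ ⊆ lam := fun M st hRS wit lam hl hsub => by
    obtain ⟨σ, hσ, -, hn, hs⟩ := wit lam hl s₀ hs₀ h01 hsub
    have h := hs.1; rw [hV1] at h
    exact hn (hRS σ hσ ⟨h.1, hs.2⟩ s₀ hs₀ h.2)
  have nf11 := nf1 M11 _ (fun σ hσ hs => hRS₁ σ hσ ⟨hs.1, hs.2.1, hs.2.2.1, hs.2.2.2⟩) wit11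
  have nf21 := nf1 M21 _ (fun σ hσ hs => hRS₂ σ hσ ⟨hs.1, hs.2.1, hs.2.2.1, hs.2.2.2⟩) wit21
  have nf2 : ∀ (M : Finset (Finset ι)) (st : Finset ι → Prop), (∀ σ, σ ⊆ E → (𝒱 σ ∧ (b ∈ C (E \ σ) ∧ b ∉ C σ) ∧ st σ) →
      ∀ t', t' < r → ¬ Disjoint (A t') σ → e t' 1 ∈ σ) → (∀ lam ∈ M, ∀ t', t' < r → t' ≠ s₂ → A t' ⊆ lam → ∃ σ, σ ⊆ E ∧
      Disjoint (A s₂) σ ∧ e t' 1 ∉ σ ∧ (V2 σ ∧ (b ∈ C (E \ σ) ∧ b ∉ C σ) ∧ st σ)) → ∀ lam ∈ M, ¬ A s₀ ⊆ lam ∧ ¬ A s₁ ⊆ lam := fun M st hRS wit lam hl =>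
    ⟨fun hsub => by
      obtain ⟨σ, hσ, -, hn, hs⟩ := wit lam hl s₀ hs₀ h02 hsub
      have h := hs.1; rw [hV2] at h
      exact hn (hRS σ hσ ⟨h.1, hs.2⟩ s₀ hs₀ h.2.1),
     fun hsub => by
      obtain ⟨σ, hσ, -, hn, hs⟩ := wit lam hl s₁ hs₁ h12 hsub
      have h := hs.1; rw [hV2] at h
      exact hn (hRS σ hσ ⟨h.1, hs.2⟩ s₁ hs₁ h.2.2)⟩
  have nf12 := nf2 M12 _ (fun σ hσ hs => hRS₁ σ hσ ⟨hs.1, hs.2.1, hs.2.2.1, hs.2.2.2⟩) wit12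
  have nf22 := nf2 M22 _ (fun σ hσ hs => hRS₂ σ hσ ⟨hs.1, hs.2.1, hs.2.2.1, hs.2.2.2⟩) wit22
  -- hence the slab of a landing (of either type) is determined
  have slab_of : ∀ lam, (lam ∈ M10 ∨ lam ∈ M20) → (lam ∈ M11 ∨ lam ∈ M21) → False := by
    intro lam h0 h1
    have hA0 : A s₀ ⊆ lam := h0.elim (fun h => (mem10 lam h).2.1) (fun h => (mem20 lam h).2.1)
    exact h1.elim (fun h => nf11 lam h hA0) (fun h => nf21 lam h hA0)
  have slab_of' : ∀ lam, (lam ∈ M10 ∨ lam ∈ M20) → (lam ∈ M12 ∨ lam ∈ M22) → False := by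
    intro lam h0 h2
    have hA0 : A s₀ ⊆ lam := h0.elim (fun h => (mem10 lam h).2.1) (fun h => (mem20 lam h).2.1)
    exact h2.elim (fun h => (nf12 lam h).1 hA0) (fun h => (nf22 lam h).1 hA0)
  have slab_of'' : ∀ lam, (lam ∈ M11 ∨ lam ∈ M21) → (lam ∈ M12 ∨ lam ∈ M22) → False := by
    intro lam h1 h2
    have hA1 : A s₁ ⊆ lam := h1.elim (fun h => (mem11 lam h).2.1) (fun h => (mem21 lam h).2.1)
    exact h2.elim (fun h => (nf12 lam h).2 hA1) (fun h => (nf22 lam h).2 hA1)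
  -- ## a common landing of the two types (same slab) has its pre-lift in P₁(𝒱): the chain lemma
  have joint : ∀ (t : ℕ) (ht : t < r) (M N : Finset (Finset ι)) (W : Finset ι → Prop),
      (∀ lam ∈ M, lam ⊆ E ∧ A t ⊆ lam ∧ 𝒱 (lam \ A t) ∧ (ha (C (lam \ A t)) = 1 ∧ hb (C (E \ (lam \ A t))) = 0)) →
      (∀ lam ∈ N, lam ⊆ E ∧ A t ⊆ lam ∧ (ka (C (lam \ A t)) = 1 ∧ kb (C (E \ (lam \ A t))) = 0)) →
      (∀ lam ∈ M, ∀ t', t' < r → t' ≠ t → A t' ⊆ lam → ∃ σ, σ ⊆ E ∧ Disjoint (A t) σ ∧ e t' 1 ∉ σ ∧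
        (W σ ∧ (b ∈ C (E \ σ) ∧ b ∉ C σ) ∧ (ha (C σ) = 1 ∧ hb (C (E \ σ)) = 0) ∧ (kb (C (E \ σ)) = 1 ∧ ka (C σ) = 0))) →
      (∀ lam ∈ N, ∀ t', t' < r → t' ≠ t → A t' ⊆ lam → ∃ σ, σ ⊆ E ∧ Disjoint (A t) σ ∧ e t' 1 ∉ σ ∧
        (W σ ∧ (b ∈ C (E \ σ) ∧ b ∉ C σ) ∧ (ka (C σ) = 1 ∧ kb (C (E \ σ)) = 0) ∧ (hb (C (E \ σ)) = 1 ∧ ha (C σ) = 0))) →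
      ∀ lam, lam ∈ M → lam ∈ N → (lam \ A t) ⊆ E ∧ 𝒱 (lam \ A t) ∧ (b ∈ C (E \ (lam \ A t)) ∧ b ∉ C (lam \ A t)) ∧
        (ha (C (lam \ A t)) = 1 ∧ ka (C (lam \ A t)) = 1 ∧ hb (C (E \ (lam \ A t))) = 0 ∧ kb (C (E \ (lam \ A t))) = 0) := by
    intro t ht M N W hM hN wM wN lam hlM hlN
    obtain ⟨hlamE, hAt, hv, hh⟩ := hM lam hlM
    obtain ⟨-, -, hk⟩ := hN lam hlN
    have hsubE : lam \ A t ⊆ E := Finset.sdiff_subset.trans hlamE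
    have hbY : b ∈ C (E \ (lam \ A t)) :=
      (full_iff _ Finset.sdiff_subset).mpr ⟨t, ht, fun x hx => Finset.mem_sdiff.mpr ⟨hAE t ht hx, fun hm => (Finset.mem_sdiff.mp hm).2 hx⟩⟩
    have hbX : b ∉ C (lam \ A t) := by
      intro hbm
      obtain ⟨t', ht', hsub'⟩ := (full_iff _ hsubE).mp hbm
      have ht't : t' ≠ t := by
        rintro rfl
        obtain ⟨x, hx⟩ := A_ne t' ht'
        exact (Finset.mem_sdiff.mp (hsub' hx)).2 hx
      have hsub : A t' ⊆ lam := hsub'.trans Finset.sdiff_subset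
      obtain ⟨σ₁, hσ₁E, hd₁, hd₁', hs₁⟩ := wM lam hlM t' ht' ht't hsub
      obtain ⟨σ₂, hσ₂E, hd₂, hd₂', hs₂⟩ := wN lam hlN t' ht' ht't hsub
      -- the third thread
      obtain ⟨o, ho, -, -, hoo⟩ := third t t' ht ht' (Ne.symm ht't)
      have hstart : ∀ σ : Finset ι, Disjoint (A t) σ → e t' 1 ∉ σ → ∀ t'', t'' < r → t'' ≠ o → e t'' 1 ∉ σ := by
        intro σ hd hd' t'' ht'' hto hm
        rcases hoo t'' ht'' hto with h | h
        · rw [h] at hm; exact Finset.disjoint_left.mp hd (heA t ht 1 (le_refl 1) (hL t ht)) hm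
        · rw [h] at hm; exact hd' hm
      have hcmp := bundle_boundary_chain ends r L w e u hw0 harc hwinj hcross E hE o σ₁ σ₂ hσ₁E hσ₂E
        (nofull σ₁ hσ₁E hs₁.2.1.2) (nofull σ₂ hσ₂E hs₂.2.1.2) (hstart σ₁ hd₁ hd₁') (hstart σ₂ hd₂ hd₂')
      rcases hcmp with hsub₀ | hsub₀
      · have h0 := hs₂.2.2.2.2
        rw [one_of_ge ha ha01 _ _ hsub₀ mha hs₁.2.2.1.1] at h0; exact one_ne_zero h0
      · have h0 := hs₁.2.2.2.2
        rw [one_of_ge ka ka01 _ _ hsub₀ mka hs₂.2.2.1.1] at h0; exact one_ne_zero h0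
    exact ⟨hsubE, hv, ⟨hbY, hbX⟩, hh.1, hk.1, hh.2, hk.2⟩
  have joint0 := joint s₀ hs₀ M10 M20 𝒱 (fun lam h => ⟨(mem10 lam h).1, (mem10 lam h).2.1, (mem10 lam h).2.2.1, (mem10 lam h).2.2.2.1⟩)
    (fun lam h => ⟨(mem20 lam h).1, (mem20 lam h).2.1, (mem20 lam h).2.2.2.1⟩) wit10 wit20
  have joint1 := joint s₁ hs₁ M11 M21 V1 (fun lam h => ⟨(mem11 lam h).1, (mem11 lam h).2.1, hV1w _ (mem11 lam h).2.2.1, (mem11 lam h).2.2.2.1⟩)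
    (fun lam h => ⟨(mem21 lam h).1, (mem21 lam h).2.1, (mem21 lam h).2.2.2.1⟩) wit11 wit21
  have joint2 := joint s₂ hs₂ M12 M22 V2 (fun lam h => ⟨(mem12 lam h).1, (mem12 lam h).2.1, hV2w _ (mem12 lam h).2.2.1, (mem12 lam h).2.2.2.1⟩)
    (fun lam h => ⟨(mem22 lam h).1, (mem22 lam h).2.1, (mem22 lam h).2.2.2.1⟩) wit12 wit22
  -- ## counting
  set M₁ : Finset (Finset ι) := M10 ∪ M11 ∪ M12 with hM₁
  set M₂ : Finset (Finset ι) := M20 ∪ M21 ∪ M22 with hM₂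
  set TT : Finset (Finset ι) := (E.powerset).filter (fun lam => 𝒱 lam ∧ (b ∈ C lam ∧ b ∉ C (E \ lam)) ∧
      ((ha (C lam) = 1 ∧ kb (C lam) = 1 ∧ hb (C (E \ lam)) = 0 ∧ ka (C (E \ lam)) = 0) ∨
        (ka (C lam) = 1 ∧ hb (C lam) = 1 ∧ kb (C (E \ lam)) = 0 ∧ ha (C (E \ lam)) = 0))) with hTT
  set JJ : Finset (Finset ι) := (E.powerset).filter (fun π => 𝒱 π ∧ (b ∈ C (E \ π) ∧ b ∉ C π) ∧
      (ha (C π) = 1 ∧ ka (C π) = 1 ∧ hb (C (E \ π)) = 0 ∧ kb (C (E \ π)) = 0)) with hJJ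
  have cM₁ : M₁.card = M10.card + M11.card + M12.card := by
    rw [hM₁, Finset.card_union_of_disjoint, Finset.card_union_of_disjoint]
    · exact Finset.disjoint_left.mpr fun lam h0 h1 => slab_of lam (Or.inl h0) (Or.inl h1)
    · exact Finset.disjoint_left.mpr fun lam h h2 => (Finset.mem_union.mp h).elim
        (fun h0 => slab_of' lam (Or.inl h0) (Or.inl h2)) (fun h1 => slab_of'' lam (Or.inl h1) (Or.inl h2))
  have cM₂ : M₂.card = M20.card + M21.card + M22.card := by
    rw [hM₂, Finset.card_union_of_disjoint, Finset.card_union_of_disjoint]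
    · exact Finset.disjoint_left.mpr fun lam h0 h1 => slab_of lam (Or.inr h0) (Or.inr h1)
    · exact Finset.disjoint_left.mpr fun lam h h2 => (Finset.mem_union.mp h).elim
        (fun h0 => slab_of' lam (Or.inr h0) (Or.inr h2)) (fun h1 => slab_of'' lam (Or.inr h1) (Or.inr h2))
  -- landings are targets
  have hTT₁ : M₁ ∪ M₂ ⊆ TT := by
    intro lam hl
    rw [hTT, Finset.mem_filter, Finset.mem_powerset]
    rcases Finset.mem_union.mp hl with h | h
    · rw [hM₁] at h
      rcases Finset.mem_union.mp h with h' | h'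
      · rcases Finset.mem_union.mp h' with h'' | h''
        · have m := mem10 lam h''; exact ⟨m.1, hV Finset.sdiff_subset m.2.2.1, m.2.2.2.2.1, Or.inl m.2.2.2.2.2⟩
        · have m := mem11 lam h''; exact ⟨m.1, hV Finset.sdiff_subset (hV1w _ m.2.2.1), m.2.2.2.2.1, Or.inl m.2.2.2.2.2⟩
      · have m := mem12 lam h'; exact ⟨m.1, hV Finset.sdiff_subset (hV2w _ m.2.2.1), m.2.2.2.2.1, Or.inl m.2.2.2.2.2⟩
    · rw [hM₂] at h
      rcases Finset.mem_union.mp h with h' | h'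
      · rcases Finset.mem_union.mp h' with h'' | h''
        · have m := mem20 lam h''; exact ⟨m.1, hV Finset.sdiff_subset m.2.2.1, m.2.2.2.2.1, Or.inr m.2.2.2.2.2⟩
        · have m := mem21 lam h''; exact ⟨m.1, hV Finset.sdiff_subset (hV1w _ m.2.2.1), m.2.2.2.2.1, Or.inr m.2.2.2.2.2⟩
      · have m := mem22 lam h'; exact ⟨m.1, hV Finset.sdiff_subset (hV2w _ m.2.2.1), m.2.2.2.2.1, Or.inr m.2.2.2.2.2⟩
  -- common landings inject into the joins via the pre-lift
  obtain ⟨pre, hpre⟩ : ∃ f : Finset ι → Finset ι, f = fun lam => if A s₀ ⊆ lam then lam \ A s₀ else if A s₁ ⊆ lam then lam \ A s₁ else lam \ A s₂ := ⟨_, rfl⟩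
  have pre_cases : ∀ lam ∈ M₁ ∩ M₂, (lam ∈ M10 ∧ lam ∈ M20 ∧ pre lam = lam \ A s₀) ∨ (lam ∈ M11 ∧ lam ∈ M21 ∧ pre lam = lam \ A s₁) ∨
      (lam ∈ M12 ∧ lam ∈ M22 ∧ pre lam = lam \ A s₂) := by
    intro lam hl
    obtain ⟨h1, h2⟩ := Finset.mem_inter.mp hl
    rw [hM₁, Finset.mem_union, Finset.mem_union] at h1
    rw [hM₂, Finset.mem_union, Finset.mem_union] at h2
    rw [hpre]
    rcases h1 with (a | a) | a <;> rcases h2 with (c | c) | c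
    · exact Or.inl ⟨a, c, by simp [(mem10 lam a).2.1]⟩
    · exact (slab_of lam (Or.inl a) (Or.inr c)).elim
    · exact (slab_of' lam (Or.inl a) (Or.inr c)).elim
    · exact (slab_of lam (Or.inr c) (Or.inl a)).elim
    · exact Or.inr (Or.inl ⟨a, c, by simp [nf11 lam a, (mem11 lam a).2.1]⟩)
    · exact (slab_of'' lam (Or.inl a) (Or.inr c)).elim
    · exact (slab_of' lam (Or.inr c) (Or.inl a)).elim
    · exact (slab_of'' lam (Or.inr c) (Or.inl a)).elim
    · exact Or.inr (Or.inr ⟨a, c, by simp [(nf12 lam a).1, (nf12 lam a).2]⟩)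
  have maps : ∀ lam ∈ M₁ ∩ M₂, pre lam ∈ JJ := by
    intro lam hl
    rw [hJJ, Finset.mem_filter, Finset.mem_powerset]
    rcases pre_cases lam hl with ⟨a, c, hp⟩ | ⟨a, c, hp⟩ | ⟨a, c, hp⟩
    · rw [hp]; exact joint0 lam a c
    · rw [hp]; exact joint1 lam a c
    · rw [hp]; exact joint2 lam a c
  -- the pre-lift determines the slab (earlier slab threads are not blue in it) and hence the landing
  have blue_iff : ∀ (lam : Finset ι) (t : ℕ), t < r → A t ⊆ lam → ∀ t', t' < r → (Disjoint (A t') (lam \ A t) ↔ (t' = t ∨ Disjoint (A t') lam)) := by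
    intro lam t ht hAt t' ht'
    constructor
    · intro hd
      by_cases htt : t' = t
      · exact Or.inl htt
      · exact Or.inr (Finset.disjoint_left.mpr fun x hx hm => Finset.disjoint_left.mp hd hx
          (Finset.mem_sdiff.mpr ⟨hm, fun hm' => Finset.disjoint_left.mp (hAdisj t' t ht' ht htt) hx hm'⟩))
    · rintro (rfl | hd)
      · exact Finset.disjoint_left.mpr fun x hx hm => (Finset.mem_sdiff.mp hm).2 hx
      · exact Finset.disjoint_of_subset_right Finset.sdiff_subset hd
  have inj : Set.InjOn pre ↑(M₁ ∩ M₂) := by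
    intro lam hl lam' hl' heq
    have hl : lam ∈ M₁ ∩ M₂ := hl
    have hl' : lam' ∈ M₁ ∩ M₂ := hl'
    -- slab data of both
    have data : ∀ μ ∈ M₁ ∩ M₂, ∃ t, t < r ∧ A t ⊆ μ ∧ pre μ = μ \ A t ∧
        (t = s₀ ∨ (t = s₁ ∧ ¬ Disjoint (A s₀) (μ \ A t)) ∨ (t = s₂ ∧ ¬ Disjoint (A s₀) (μ \ A t) ∧ ¬ Disjoint (A s₁) (μ \ A t))) := by
      intro μ hμ
      rcases pre_cases μ hμ with ⟨a, -, hp⟩ | ⟨a, -, hp⟩ | ⟨a, -, hp⟩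
      · exact ⟨s₀, hs₀, (mem10 μ a).2.1, hp, Or.inl rfl⟩
      · have hv := (mem11 μ a).2.2.1; rw [hV1] at hv
        exact ⟨s₁, hs₁, (mem11 μ a).2.1, hp, Or.inr (Or.inl ⟨rfl, hv.2⟩)⟩
      · have hv := (mem12 μ a).2.2.1; rw [hV2] at hv
        exact ⟨s₂, hs₂, (mem12 μ a).2.1, hp, Or.inr (Or.inr ⟨rfl, hv.2.1, hv.2.2⟩)⟩
    obtain ⟨t, ht, hAt, hp, hc⟩ := data lam hl
    obtain ⟨t', ht', hAt', hp', hc'⟩ := data lam' hl'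
    have heq' : lam \ A t = lam' \ A t' := by rw [← hp, ← hp']; exact heq
    -- t is blue in the common pre-lift, the restrictions force t = t'
    have hdt : Disjoint (A t) (lam' \ A t') := by rw [← heq']; exact (blue_iff lam t ht hAt t ht).mpr (Or.inl rfl)
    have hdt' : Disjoint (A t') (lam \ A t) := by rw [heq']; exact (blue_iff lam' t' ht' hAt' t' ht').mpr (Or.inl rfl)
    have htt : t = t' := by
      rcases (blue_iff lam' t' ht' hAt' t ht).mp hdt with h | h
      · exact h
      · -- t is blue in lam' : impossible for the slab thread pattern unless forced by the restriction clauses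
        rcases hc with rfl | ⟨rfl, h1⟩ | ⟨rfl, h1, h2⟩ <;> rcases hc' with rfl | ⟨rfl, h1'⟩ | ⟨rfl, h1', h2'⟩
        all_goals first | rfl | exact absurd (Finset.disjoint_of_subset_right Finset.sdiff_subset h) h1' |
          exact absurd (Finset.disjoint_of_subset_right Finset.sdiff_subset h) h2' | skip
        all_goals exfalso
        all_goals first | exact h1 hdt' | exact h2 hdt'
    subst htt
    calc lam = (lam \ A t) ∪ A t := (Finset.sdiff_union_of_subset hAt).symm
      _ = (lam' \ A t) ∪ A t := by rw [heq']
      _ = lam' := Finset.sdiff_union_of_subset hAt'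
  have cJ : (M₁ ∩ M₂).card ≤ JJ.card := Finset.card_le_card_of_injOn pre (fun lam hl => maps lam hl) inj
  -- sources are covered by the three slabs
  have cover : ∀ (st : Finset ι → Prop),
      ((E.powerset).filter (fun σ => 𝒱 σ ∧ (b ∈ C (E \ σ) ∧ b ∉ C σ) ∧ st σ)).card ≤
        ((E.powerset).filter (fun σ => Disjoint (A s₀) σ ∧ 𝒱 σ ∧ (b ∈ C (E \ σ) ∧ b ∉ C σ) ∧ st σ)).card +
        ((E.powerset).filter (fun σ => Disjoint (A s₁) σ ∧ V1 σ ∧ (b ∈ C (E \ σ) ∧ b ∉ C σ) ∧ st σ)).card +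
        ((E.powerset).filter (fun σ => Disjoint (A s₂) σ ∧ V2 σ ∧ (b ∈ C (E \ σ) ∧ b ∉ C σ) ∧ st σ)).card := by
    intro st
    refine le_trans (Finset.card_le_card ?_) ((Finset.card_union_le _ _).trans (Nat.add_le_add_right (Finset.card_union_le _ _) _))
    intro σ hσ
    rw [Finset.mem_filter, Finset.mem_powerset] at hσ
    obtain ⟨hσE, hv, hd, hs⟩ := hσ
    rw [Finset.mem_union, Finset.mem_union, Finset.mem_filter, Finset.mem_filter, Finset.mem_filter, Finset.mem_powerset, hV1, hV2]
    by_cases d0 : Disjoint (A s₀) σ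
    · exact Or.inl (Or.inl ⟨hσE, d0, hv, hd, hs⟩)
    by_cases d1 : Disjoint (A s₁) σ
    · exact Or.inl (Or.inr ⟨hσE, d1, ⟨hv, d0⟩, hd, hs⟩)
    obtain ⟨t, ht, hsub⟩ := (full_iff (E \ σ) Finset.sdiff_subset).mp hd.1
    have hdt : Disjoint (A t) σ := Finset.disjoint_left.mpr fun x hx hm => (Finset.mem_sdiff.mp (hsub hx)).2 hm
    rcases hr3 t ht with h | h | h
    · rw [h] at hdt; exact absurd hdt d0
    · rw [h] at hdt; exact absurd hdt d1
    · rw [h] at hdt; exact Or.inr ⟨hσE, hdt, ⟨hv, d0, d1⟩, hd, hs⟩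
  have c₁ : ((E.powerset).filter (fun σ => 𝒱 σ ∧ (b ∈ C (E \ σ) ∧ b ∉ C σ) ∧ ((ha (C σ) = 1 ∧ hb (C (E \ σ)) = 0) ∧
      (kb (C (E \ σ)) = 1 ∧ ka (C σ) = 0)))).card ≤ M₁.card := by
    have h := cover (fun σ => (ha (C σ) = 1 ∧ hb (C (E \ σ)) = 0) ∧ (kb (C (E \ σ)) = 1 ∧ ka (C σ) = 0))
    have h10 : ((E.powerset).filter (fun σ => Disjoint (A s₀) σ ∧ 𝒱 σ ∧ (b ∈ C (E \ σ) ∧ b ∉ C σ) ∧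
        ((ha (C σ) = 1 ∧ hb (C (E \ σ)) = 0) ∧ (kb (C (E \ σ)) = 1 ∧ ka (C σ) = 0)))).card ≤ M10.card := by convert le10 using 3
    have h11 : ((E.powerset).filter (fun σ => Disjoint (A s₁) σ ∧ V1 σ ∧ (b ∈ C (E \ σ) ∧ b ∉ C σ) ∧
        ((ha (C σ) = 1 ∧ hb (C (E \ σ)) = 0) ∧ (kb (C (E \ σ)) = 1 ∧ ka (C σ) = 0)))).card ≤ M11.card := by convert le11 using 3
    have h12' : ((E.powerset).filter (fun σ => Disjoint (A s₂) σ ∧ V2 σ ∧ (b ∈ C (E \ σ) ∧ b ∉ C σ) ∧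
        ((ha (C σ) = 1 ∧ hb (C (E \ σ)) = 0) ∧ (kb (C (E \ σ)) = 1 ∧ ka (C σ) = 0)))).card ≤ M12.card := by convert le12 using 3
    have h0 : ((E.powerset).filter (fun σ => 𝒱 σ ∧ (b ∈ C (E \ σ) ∧ b ∉ C σ) ∧ ((ha (C σ) = 1 ∧ hb (C (E \ σ)) = 0) ∧
        (kb (C (E \ σ)) = 1 ∧ ka (C σ) = 0)))).card ≤
        ((E.powerset).filter (fun σ => Disjoint (A s₀) σ ∧ 𝒱 σ ∧ (b ∈ C (E \ σ) ∧ b ∉ C σ) ∧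
          ((ha (C σ) = 1 ∧ hb (C (E \ σ)) = 0) ∧ (kb (C (E \ σ)) = 1 ∧ ka (C σ) = 0)))).card +
        ((E.powerset).filter (fun σ => Disjoint (A s₁) σ ∧ V1 σ ∧ (b ∈ C (E \ σ) ∧ b ∉ C σ) ∧
          ((ha (C σ) = 1 ∧ hb (C (E \ σ)) = 0) ∧ (kb (C (E \ σ)) = 1 ∧ ka (C σ) = 0)))).card +
        ((E.powerset).filter (fun σ => Disjoint (A s₂) σ ∧ V2 σ ∧ (b ∈ C (E \ σ) ∧ b ∉ C σ) ∧
          ((ha (C σ) = 1 ∧ hb (C (E \ σ)) = 0) ∧ (kb (C (E \ σ)) = 1 ∧ ka (C σ) = 0)))).card := by convert h using 6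
    rw [cM₁]
    exact h0.trans (Nat.add_le_add (Nat.add_le_add h10 h11) h12')
  have c₂ : ((E.powerset).filter (fun σ => 𝒱 σ ∧ (b ∈ C (E \ σ) ∧ b ∉ C σ) ∧ ((ka (C σ) = 1 ∧ kb (C (E \ σ)) = 0) ∧
      (hb (C (E \ σ)) = 1 ∧ ha (C σ) = 0)))).card ≤ M₂.card := by
    have h := cover (fun σ => (ka (C σ) = 1 ∧ kb (C (E \ σ)) = 0) ∧ (hb (C (E \ σ)) = 1 ∧ ha (C σ) = 0))
    have h20 : ((E.powerset).filter (fun σ => Disjoint (A s₀) σ ∧ 𝒱 σ ∧ (b ∈ C (E \ σ) ∧ b ∉ C σ) ∧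
        ((ka (C σ) = 1 ∧ kb (C (E \ σ)) = 0) ∧ (hb (C (E \ σ)) = 1 ∧ ha (C σ) = 0)))).card ≤ M20.card := by convert le20 using 3
    have h21 : ((E.powerset).filter (fun σ => Disjoint (A s₁) σ ∧ V1 σ ∧ (b ∈ C (E \ σ) ∧ b ∉ C σ) ∧
        ((ka (C σ) = 1 ∧ kb (C (E \ σ)) = 0) ∧ (hb (C (E \ σ)) = 1 ∧ ha (C σ) = 0)))).card ≤ M21.card := by convert le21 using 3
    have h22' : ((E.powerset).filter (fun σ => Disjoint (A s₂) σ ∧ V2 σ ∧ (b ∈ C (E \ σ) ∧ b ∉ C σ) ∧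
        ((ka (C σ) = 1 ∧ kb (C (E \ σ)) = 0) ∧ (hb (C (E \ σ)) = 1 ∧ ha (C σ) = 0)))).card ≤ M22.card := by convert le22 using 3
    have h0 : ((E.powerset).filter (fun σ => 𝒱 σ ∧ (b ∈ C (E \ σ) ∧ b ∉ C σ) ∧ ((ka (C σ) = 1 ∧ kb (C (E \ σ)) = 0) ∧
        (hb (C (E \ σ)) = 1 ∧ ha (C σ) = 0)))).card ≤
        ((E.powerset).filter (fun σ => Disjoint (A s₀) σ ∧ 𝒱 σ ∧ (b ∈ C (E \ σ) ∧ b ∉ C σ) ∧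
          ((ka (C σ) = 1 ∧ kb (C (E \ σ)) = 0) ∧ (hb (C (E \ σ)) = 1 ∧ ha (C σ) = 0)))).card +
        ((E.powerset).filter (fun σ => Disjoint (A s₁) σ ∧ V1 σ ∧ (b ∈ C (E \ σ) ∧ b ∉ C σ) ∧
          ((ka (C σ) = 1 ∧ kb (C (E \ σ)) = 0) ∧ (hb (C (E \ σ)) = 1 ∧ ha (C σ) = 0)))).card +
        ((E.powerset).filter (fun σ => Disjoint (A s₂) σ ∧ V2 σ ∧ (b ∈ C (E \ σ) ∧ b ∉ C σ) ∧
          ((ka (C σ) = 1 ∧ kb (C (E \ σ)) = 0) ∧ (hb (C (E \ σ)) = 1 ∧ ha (C σ) = 0)))).card := by convert h using 6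
    rw [cM₂]
    exact h0.trans (Nat.add_le_add (Nat.add_le_add h20 h21) h22')
  have e3 := Finset.card_union_add_card_inter M₁ M₂
  have cT : (M₁ ∪ M₂).card ≤ TT.card := Finset.card_le_card hTT₁
  have c₁' : ((E.powerset).filter (fun σ => 𝒱 σ ∧ (b ∈ openCluster (ends '' (↑(E \ σ) : Set ι)) u ∧ b ∉ openCluster (ends '' (↑σ : Set ι)) u) ∧
      (ha (openCluster (ends '' (↑σ : Set ι)) u) = 1 ∧ hb (openCluster (ends '' (↑(E \ σ) : Set ι)) u) = 0) ∧
      (kb (openCluster (ends '' (↑(E \ σ) : Set ι)) u) = 1 ∧ ka (openCluster (ends '' (↑σ : Set ι)) u) = 0))).card ≤ M₁.card := by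
    convert c₁ using 3
  have c₂' : ((E.powerset).filter (fun σ => 𝒱 σ ∧ (b ∈ openCluster (ends '' (↑(E \ σ) : Set ι)) u ∧ b ∉ openCluster (ends '' (↑σ : Set ι)) u) ∧
      (ka (openCluster (ends '' (↑σ : Set ι)) u) = 1 ∧ kb (openCluster (ends '' (↑(E \ σ) : Set ι)) u) = 0) ∧
      (hb (openCluster (ends '' (↑(E \ σ) : Set ι)) u) = 1 ∧ ha (openCluster (ends '' (↑σ : Set ι)) u) = 0))).card ≤ M₂.card := by
    convert c₂ using 3
  have cT' : (M₁ ∪ M₂).card ≤ ((E.powerset).filter (fun lam => 𝒱 lam ∧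
      (b ∈ openCluster (ends '' (↑lam : Set ι)) u ∧ b ∉ openCluster (ends '' (↑(E \ lam) : Set ι)) u) ∧
      ((ha (openCluster (ends '' (↑lam : Set ι)) u) = 1 ∧ kb (openCluster (ends '' (↑lam : Set ι)) u) = 1 ∧
          hb (openCluster (ends '' (↑(E \ lam) : Set ι)) u) = 0 ∧ ka (openCluster (ends '' (↑(E \ lam) : Set ι)) u) = 0) ∨
        (ka (openCluster (ends '' (↑lam : Set ι)) u) = 1 ∧ hb (openCluster (ends '' (↑lam : Set ι)) u) = 1 ∧
          kb (openCluster (ends '' (↑(E \ lam) : Set ι)) u) = 0 ∧ ha (openCluster (ends '' (↑(E \ lam) : Set ι)) u) = 0)))).card := by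
    convert cT using 3
  have cJ' : (M₁ ∩ M₂).card ≤ ((E.powerset).filter (fun π => 𝒱 π ∧
      (b ∈ openCluster (ends '' (↑(E \ π) : Set ι)) u ∧ b ∉ openCluster (ends '' (↑π : Set ι)) u) ∧
      (ha (openCluster (ends '' (↑π : Set ι)) u) = 1 ∧ ka (openCluster (ends '' (↑π : Set ι)) u) = 1 ∧
        hb (openCluster (ends '' (↑(E \ π) : Set ι)) u) = 0 ∧ kb (openCluster (ends '' (↑(E \ π) : Set ι)) u) = 0))).card := by
    convert cJ using 3
  omega

end Coefficientwise

end Summit.CriticalPhenomena.PercolationContinuityZ3.Theorems
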